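import Literature.Computability.AlgebraicComplexity.BI17GenericTernaryQuarticPeriod
import Literature.Computability.AlgebraicComplexity.BI17OddCayleyInvariantProofs
import HarnessLib

/-!
# Generic stabilizer periods of forms of odd degree: `a(w) ∣ 2D` (when `2m ≤ binom(2D,D)`) and
# `a(w) ∣ 2` for `m = D` odd — in particular the generic ternary cubic has `a(w) ∈ {1, 2}`
# (Bürgisser–Ikenmeyer 2017, Thm. 2.3 / App. Prop. 7.5 (1), the half given by invariant degrees)

Theorem-only companion (cell `val-lit`, row BI2017-A; no definitions, no named facts) of
`BI17FundamentalInvariantForms.lean`. P. Bürgisser, C. Ikenmeyer, *Fundamental invariants of orbit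
closures*, J. Algebra 477 (2017) = arXiv:1511.02927, Thm. 2.3 (main.tex L473–481; "`a'(3,3) = 2`")
and App. Prop. 7.5 (1) (L2976–2980: "A generic `w ∈ Sym³ℂ³` satisfies `stab(w) ≃ μ_3 ⋊ S_3`. Hence
`a'(3,3) = 2`"), typed as conjunct 1 of the named fact `BI2017_prop_A_5` (whose conjunct 2 is refuted
in the tree, `not_BI2017_prop_A_5`).

Continuing the invariant-degree mechanism of the sibling files (`BI17GenericTernaryQuarticPeriod`,
`BI17GenericPeriodEvenDegreeCoprime`; BI's own proof of Lemma 3.2 (1): a homogeneous `SL_m`-invariant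
of degree `d` nonvanishing at `w` forces `det(g)^{Dd/m} = 1` on `stab(w)`), this file PROVES for
Zariski-generic forms `w ∈ Sym^D ℂ^m`:

* `D` odd, `m ≥ 2`, `2m ≤ binom(2D,D)`: `0 < a(w) ∣ 2D` — from the tableau invariant of degree `2m`
  of BI Prop. 3.24 (2) (the tree's `exists_tableau_aeval_psum_eq_factorial`: nonzero at the power
  sum), weight `det^{2D}` (`isZariskiGeneric_stabilizerPeriod_dvd_two_mul_of_odd`);
* `D = m` odd, `D ≥ 3`: `0 < a(w) ∣ 2` — adding BI's `P_D` of degree `D + 1` (eq. (3.7); nonzero for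
  odd `D`, Thm. 3.22 (2), the tree's `oddCayleyP_ne_zero_of_odd`), weight `det^{D+1}`, and
  `gcd(2D, D+1) = 2` (`isZariskiGeneric_stabilizerPeriod_dvd_two_of_odd_self`);
* hence the generic ternary cubic has `a(w) = 1 ∨ a(w) = 2`
  (`isZariskiGeneric_ternaryCubic_stabilizerPeriod_le_two`).

HONEST PARTIAL: the printed value `a(3,3) = 2` (equivalently `a'(3,3) = 2`, conjunct 1 of
`BI2017_prop_A_5`) needs, in addition, an element of determinant `-1` in the stabilizer of a generic
ternary cubic (the inversion `[-1]` about a flex of the smooth plane cubic, i.e. the existence of a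
flex point — two plane curves meet); that half is NOT proved here.

Honest framing: bookkeeping of classical invariant theory inside the BIP literature programme;
nothing here bears on VP versus VNP.

## References

* [BurgisserIkenmeyer2017] P. Bürgisser, C. Ikenmeyer, J. Algebra 477 (2017) 390–434 =
  arXiv:1511.02927, Thm. 2.3, App. Prop. 7.5 (1), Lemma 3.2 (1), Prop. 3.24 (2), eq. (3.7),
  Thm. 3.22 (2).

## Tree

`stabilizerDetImage`, `stabilizerPeriod_def`, `IsZariskiGeneric`, `slInvariantsOfDegree`, `oddCayleyP`
(`BI17FundamentalInvariantForms`); `tableauInvPoly_mem_slInvariantsOfDegree`,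
`exists_tableau_aeval_psum_eq_factorial` (`BI17PowerSumDegreeProofs`); `oddCayleyP_ne_zero_of_odd`
(`BI17OddCayleyInvariantProofs`); `stabilizerDetImage_le_rootsOfUnity_of_aeval_ne_zero`
(`BI17GenericTernaryQuarticPeriod`); `IsZariskiGeneric.false_of_disjoint` pattern
(`Poonen05HypersurfaceLinearAutomorphisms`). Mathlib: `rootsOfUnity`, `Complex.card_rootsOfUnity`,
`pow_gcd_eq_one`, `Subgroup.card_dvd_of_le`.
-/

noncomputable section

open MvPolynomial

namespace Literature.Computability.AlgebraicComplexity

section OddDegree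

variable {D m : ℕ}

/-- **From `det(stab w) ≤ μ_N` to `0 < a(w) ∣ N`** (`N ≥ 1`): a subgroup of the `N`-th roots of unity of
`ℂ` is finite of order dividing `N`. [cite: BurgisserIkenmeyer2017, §2.1 (Def. 2.2)] -/
theorem stabilizerPeriod_pos_and_dvd_of_le_rootsOfUnity {σ : Type*} [Fintype σ] [DecidableEq σ]
    {N : ℕ} [NeZero N] {w : MvPolynomial σ ℂ} (hle : stabilizerDetImage w ≤ rootsOfUnity N ℂ) :
    stabilizerPeriod w ≠ 0 ∧ stabilizerPeriod w ∣ N := by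
  have hfin : Finite (stabilizerDetImage w) :=
    Finite.of_injective (Subgroup.inclusion hle) (Subgroup.inclusion_injective hle)
  refine ⟨?_, ?_⟩
  · rw [stabilizerPeriod_def]
    exact Nat.card_pos.ne'
  · rw [stabilizerPeriod_def, ← Complex.card_rootsOfUnity N]
    exact Subgroup.card_dvd_of_le hle

/-- **BI 2017 Prop. 3.24 (2)'s tableau invariant as a genericity polynomial**: for `D ≥ 1` and
`2m ≤ binom(2D,D)` there is a NONZERO `SL_m`-invariant of degree `2m` on `Sym^D ℂ^m` (its value at the
power sum `X_1^D + ⋯ + X_m^D` is `m!`). [cite: BurgisserIkenmeyer2017, Prop. 3.24 (proof)] -/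
theorem exists_slInvariant_two_mul_ne_zero (hD : 0 < D) (h2m : 2 * m ≤ Nat.choose (2 * D) D) :
    ∃ F : MvPolynomial (DegIdx (Fin m) D) ℂ, F ≠ 0 ∧ F ∈ slInvariantsOfDegree (Fin m) ℂ D (2 * m) := by
  obtain ⟨β, hβ⟩ := exists_tableau_aeval_psum_eq_factorial (k := ℂ) (m := m) hD h2m
  refine ⟨tableauInvPoly (k := ℂ) D β id, ?_, tableauInvPoly_mem_slInvariantsOfDegree β⟩
  intro h0
  rw [h0, map_zero] at hβ
  exact Nat.cast_ne_zero.mpr (Nat.factorial_ne_zero m) hβ.symm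

/-- **For odd `D ≥ 1`, `m ≥ 2` with `2m ≤ binom(2D,D)`, almost all `w ∈ Sym^D ℂ^m` have a finite
stabilizer period dividing `2D`**: `det(stab w) ≤ μ_{2D}` off the zero set of the degree-`2m` tableau
invariant (weight `det^{D·2m/m} = det^{2D}`, BI Lemma 3.2 (1)). (BI Thm. 2.3 predicts `a'(D,m) = 1`,
i.e. `a(D,m) = D / gcd(D,m)`, in this range except `a(3,2) = 6`, `a(3,3) = 2`; the odd-degree cases
rest on generic-stabilizer theorems not in the tree.) [cite: BurgisserIkenmeyer2017, Thm. 2.3] -/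
theorem isZariskiGeneric_stabilizerPeriod_dvd_two_mul_of_odd (hD : 0 < D) (hm : 2 ≤ m)
    (h2m : 2 * m ≤ Nat.choose (2 * D) D) :
    IsZariskiGeneric D (fun f : MvPolynomial (Fin m) ℂ =>
      stabilizerPeriod f ≠ 0 ∧ stabilizerPeriod f ∣ 2 * D) := by
  haveI : NeZero (2 * D) := ⟨by omega⟩
  obtain ⟨F, hF0, hF⟩ := exists_slInvariant_two_mul_ne_zero (m := m) hD h2m
  refine ⟨F, hF0, fun f hf hFf => ?_⟩
  exact stabilizerPeriod_pos_and_dvd_of_le_rootsOfUnity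
    (stabilizerDetImage_le_rootsOfUnity_of_aeval_ne_zero (by omega) hf hF (by ring) hFf)

/-- **For odd `D ≥ 3` and `m = D`, almost all `w ∈ Sym^D ℂ^D` have `0 < a(w) ∣ 2`**: the tableau
invariant of degree `2D` (weight `det^{2D}`) and BI's `P_D` of degree `D + 1` (eq. (3.7), nonzero for
odd `D` by Thm. 3.22 (2); weight `det^{D+1}`) do not vanish, and `gcd(2D, D+1) = 2`.
[cite: BurgisserIkenmeyer2017, Thm. 3.22(2)] -/
theorem isZariskiGeneric_stabilizerPeriod_dvd_two_of_odd_self (hDodd : Odd D) (hD : 3 ≤ D) :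
    IsZariskiGeneric D (fun f : MvPolynomial (Fin D) ℂ =>
      stabilizerPeriod f ≠ 0 ∧ stabilizerPeriod f ∣ 2) := by
  obtain ⟨F, hF0, hF⟩ :=
    exists_slInvariant_two_mul_ne_zero (D := D) (m := D) (by omega) (by
      -- `2D = binom(2D,1) ≤ binom(2D,D)`
      have h := Nat.choose_le_middle 1 (2 * D)
      rwa [Nat.choose_one_right, Nat.mul_div_cancel_left D two_pos] at h)
  have hP0 : oddCayleyP (k := ℂ) D (Equiv.refl (Fin D)) ≠ 0 := oddCayleyP_ne_zero_of_odd hDodd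
  have hPmem : oddCayleyP (k := ℂ) D (Equiv.refl (Fin D)) ∈ slInvariantsOfDegree (Fin D) ℂ D (D + 1) := by
    change tableauInvPoly (k := ℂ) D (cyclicTableau D) id ∈ _
    exact tableauInvPoly_mem_slInvariantsOfDegree _
  refine ⟨F * oddCayleyP (k := ℂ) D (Equiv.refl (Fin D)), mul_ne_zero hF0 hP0, fun f hf hFP => ?_⟩
  rw [map_mul] at hFP
  have hFf : aeval (formCoeff D f) F ≠ 0 := left_ne_zero_of_mul hFP
  have hPf : aeval (formCoeff D f) (oddCayleyP (k := ℂ) D (Equiv.refl (Fin D))) ≠ 0 :=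
    right_ne_zero_of_mul hFP
  -- `det(stab f) ≤ μ_{2D} ⊓ μ_{D+1} = μ_2`
  have hgcd : Nat.gcd (2 * D) (D + 1) = 2 := by
    obtain ⟨k, rfl⟩ := hDodd
    have h2 : 2 ∣ Nat.gcd (2 * (2 * k + 1)) (2 * k + 1 + 1) :=
      Nat.dvd_gcd (dvd_mul_right 2 _) ⟨k + 1, by ring⟩
    have hle : Nat.gcd (2 * (2 * k + 1)) (2 * k + 1 + 1) ∣ 2 := by
      have ha := Nat.gcd_dvd_left (2 * (2 * k + 1)) (2 * k + 1 + 1)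
      have hb := Nat.gcd_dvd_right (2 * (2 * k + 1)) (2 * k + 1 + 1)
      have hc : Nat.gcd (2 * (2 * k + 1)) (2 * k + 1 + 1) ∣ 2 * (2 * k + 1 + 1) := hb.mul_left 2
      have hsub := Nat.dvd_sub hc ha
      rwa [show 2 * (2 * k + 1 + 1) - 2 * (2 * k + 1) = 2 by omega] at hsub
    exact Nat.dvd_antisymm hle h2
  have hle : stabilizerDetImage f ≤ rootsOfUnity 2 ℂ := by
    intro u hu
    obtain ⟨g, hg, rfl⟩ := (mem_stabilizerDetImage_iff f u).mp hu
    rw [mem_rootsOfUnity]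
    apply Units.ext
    rw [Units.val_pow_eq_pow_val, Units.val_one, ← hgcd]
    exact pow_gcd_eq_one.mpr
      ⟨det_pow_eq_one_of_mem_linStabilizer_of_aeval_ne_zero (by omega) hf hF (by ring) hFf hg,
        det_pow_eq_one_of_mem_linStabilizer_of_aeval_ne_zero (by omega) hf hPmem (by ring) hPf hg⟩
  exact stabilizerPeriod_pos_and_dvd_of_le_rootsOfUnity hle

/-- **The generic ternary cubic has stabilizer period `1` or `2`** (`D = m = 3`): the half of BI 2017
App. Prop. 7.5 (1) / Thm. 2.3 "`a'(3,3) = 2`" (`a'(w) = a(w) · gcd(3,3) / 3 = a(w)` here) given by the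
invariants of degrees `4` (`P_3`, Aronhold's `S` up to scale) and `6`. HONEST PARTIAL: `a(w) = 2`
(an element of determinant `-1`, the inversion about a flex) is not proved.
[cite: BurgisserIkenmeyer2017, §7 (Appendix) Prop. 7.5 (1)] -/
theorem isZariskiGeneric_ternaryCubic_stabilizerPeriod_le_two :
    IsZariskiGeneric 3 (fun f : MvPolynomial (Fin 3) ℂ =>
      stabilizerPeriod f = 1 ∨ stabilizerPeriod f = 2) := by
  obtain ⟨F, hF0, hF⟩ := isZariskiGeneric_stabilizerPeriod_dvd_two_of_odd_self (D := 3)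
    (by decide) le_rfl
  refine ⟨F, hF0, fun f hf hFf => ?_⟩
  have h12 : stabilizerPeriod f ≠ 0 ∧ stabilizerPeriod f ∣ 2 := hF f hf hFf
  obtain ⟨h0, h2⟩ := h12
  show stabilizerPeriod f = 1 ∨ stabilizerPeriod f = 2
  have hle : stabilizerPeriod f ≤ 2 := Nat.le_of_dvd two_pos h2
  interval_cases h : stabilizerPeriod f
  · exact absurd rfl h0
  · exact Or.inl rfl
  · exact Or.inr rfl

/-- The same in the shape of conjunct 1 of `BI2017_prop_A_5` (`reducedStabilizerPeriod 3 f = a(f)`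
for ternary cubics): generically `a'(w) = 1 ∨ a'(w) = 2`.
[cite: BurgisserIkenmeyer2017, §7 (Appendix) Prop. 7.5 (1)] -/
theorem isZariskiGeneric_ternaryCubic_reducedStabilizerPeriod_le_two :
    IsZariskiGeneric 3 (fun f : MvPolynomial (Fin 3) ℂ =>
      reducedStabilizerPeriod 3 f = 1 ∨ reducedStabilizerPeriod 3 f = 2) := by
  obtain ⟨F, hF0, hF⟩ := isZariskiGeneric_ternaryCubic_stabilizerPeriod_le_two
  refine ⟨F, hF0, fun f hf hFf => ?_⟩
  have h : stabilizerPeriod f = 1 ∨ stabilizerPeriod f = 2 := hF f hf hFf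
  have hred : reducedStabilizerPeriod 3 f = stabilizerPeriod f := by
    rw [reducedStabilizerPeriod, Fintype.card_fin, Nat.gcd_self, Nat.mul_div_cancel _ three_pos]
  show reducedStabilizerPeriod 3 f = 1 ∨ reducedStabilizerPeriod 3 f = 2
  rw [hred]
  exact h

end OddDegree

end Literature.Computability.AlgebraicComplexity

end
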